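import Summits.ABC.ABC.Theses.RibetTakahashiSplit

/-!
# `ManyPrimeValuationProduct` (stmt-ABC-1561), line `unramified-window-census`: the many-prime
hypothesis `4 ≤ #{odd multiplicative primes}` is removable in `stub_midCensus`

Negative support / hypothesis mutation (drefute seat `refuter-drefute-stmt-ABC-1561-g3-0`, 2026-08-16).
`stub_midCensus` (skeleton `Cruxes/ManyPrimeValuationProduct/Lines/unramified-window-census.lean`, rev 2/3)
carries the class hypotheses of the crux verbatim: semistable away from `2`, and at least four odd
multiplicative primes. The second hypothesis is what the route's Ribet–Takahashi mechanism needs (three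
admissible factorisations `N = DM` covering all multiplicative primes exist iff there are `≥ 4` odd ones,
Pasten Thm 6.1(b)); this file shows it gives the census stub NOTHING: a curve with at most three odd
multiplicative primes has at most four primes `p ∥ N`, so its census is at most `4 log log N`, and
`4 log L ≤ ε L + 4 log (4/ε) − 4` for every `L > 0` (`four_mul_log_le`). Hence
`midCensus_iff_dropFour`: the stub as registered is EQUIVALENT to the same statement over all elliptic
curves semistable away from `2`, with the explicit constant change `C ↦ max C 0 ⊔ 4 log (4/ε)`.
Reading for the prover: any proof of `stub_midCensus` is a proof for every curve semistable away from `2`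
(in particular for every semistable curve and every Frey curve); the many-prime hypothesis cannot be where
a lever acts. (For `stub_giantMass` the same mutation is truth-inert — Szpiro implies it with or without the
hypothesis — but not free: with `≤ 4` primes the giant mass is `≤ 4 · max_p log v_p`, i.e. the one-prime
sub-exponential Szpiro bound, which is the few-prime crux r4's difficulty.)
-/

noncomputable section

-- `Summit.<Summit>.<Problem>`: for the single-conjunct summit `ABC` the duplicate `ABC.ABC` is mandated.
set_option linter.dupNamespace false

namespace Summit.ABC.ABC.Theorems.ManyPrimeValuationProduct.Negative

open Real Finset

/-- The multiplicative primes are the odd multiplicative primes plus possibly `2`. [folklore] -/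
theorem card_filter_not_sq_dvd_le (N : ℕ) :
    (N.primeFactors.filter (fun p => ¬ p ^ 2 ∣ N)).card ≤
      1 + (N.primeFactors.filter (fun p => p ≠ 2 ∧ ¬ p ^ 2 ∣ N)).card := by
  have hsub : N.primeFactors.filter (fun p => ¬ p ^ 2 ∣ N) ⊆
      insert 2 (N.primeFactors.filter (fun p => p ≠ 2 ∧ ¬ p ^ 2 ∣ N)) := by
    intro p hp
    rw [Finset.mem_filter] at hp
    rw [Finset.mem_insert, Finset.mem_filter]
    by_cases h2 : p = 2
    · exact Or.inl h2
    · exact Or.inr ⟨hp.1, h2, hp.2⟩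
  exact (Finset.card_le_card hsub).trans ((Finset.card_insert_le _ _).trans (by omega))

/-- The real-arithmetic heart: `4 log L ≤ ε L + 4 log (4/ε) − 4` for `L, ε > 0`
(`log x ≤ x − 1` at `x = ε L / 4`). [folklore] -/
theorem four_mul_log_le {ε L : ℝ} (hε : 0 < ε) (hL : 0 < L) :
    4 * Real.log L ≤ ε * L + 4 * Real.log (4 / ε) - 4 := by
  have hx : 0 < ε * L / 4 := by positivity
  have h1 : Real.log (ε * L / 4) ≤ ε * L / 4 - 1 := Real.log_le_sub_one_of_pos hx
  have h2 : Real.log (ε * L / 4) = Real.log L - Real.log (4 / ε) := by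
    rw [Real.log_div (by positivity) (by norm_num), Real.log_mul hε.ne' hL.ne',
      Real.log_div (by norm_num) hε.ne']
    ring
  linarith

/-- **`stub_midCensus` does not use the many-prime hypothesis**: the registered stub (with
`4 ≤ #{p ∥ N odd}`) is equivalent to the census over ALL elliptic curves semistable away from `2`.
Forward direction: curves with `≤ 3` odd multiplicative primes have census `≤ 4 log log N ≤
ε log N + 4 log (4/ε)`. [folklore] -/
theorem midCensus_iff_dropFour :
    (∀ ε : ℝ, 0 < ε → ∃ C : ℝ, ∀ (W : WeierstrassCurve ℚ) [W.IsElliptic],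
      (∀ p : ℕ, p.Prime → p ≠ 2 → ¬ p ^ 2 ∣ W.conductorNorm ℤ) →
      4 ≤ ((W.conductorNorm ℤ).primeFactors.filter
        (fun p => p ≠ 2 ∧ ¬ p ^ 2 ∣ W.conductorNorm ℤ)).card →
      ((((W.conductorNorm ℤ).primeFactors.filter (fun p => ¬ p ^ 2 ∣ W.conductorNorm ℤ)).filter
          (fun p => ε * Real.log (Real.log (W.conductorNorm ℤ)) <
            Real.log ((W.minimalDiscriminantNorm ℤ).factorization p))).card : ℝ) *
        Real.log (Real.log (W.conductorNorm ℤ)) ≤ ε * Real.log (W.conductorNorm ℤ) + C) ↔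
    (∀ ε : ℝ, 0 < ε → ∃ C : ℝ, ∀ (W : WeierstrassCurve ℚ) [W.IsElliptic],
      (∀ p : ℕ, p.Prime → p ≠ 2 → ¬ p ^ 2 ∣ W.conductorNorm ℤ) →
      ((((W.conductorNorm ℤ).primeFactors.filter (fun p => ¬ p ^ 2 ∣ W.conductorNorm ℤ)).filter
          (fun p => ε * Real.log (Real.log (W.conductorNorm ℤ)) <
            Real.log ((W.minimalDiscriminantNorm ℤ).factorization p))).card : ℝ) *
        Real.log (Real.log (W.conductorNorm ℤ)) ≤ ε * Real.log (W.conductorNorm ℤ) + C) := by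
  constructor
  · intro h ε hε
    obtain ⟨C, hC⟩ := h ε hε
    refine ⟨max (max C 0) (4 * Real.log (4 / ε)), fun W _ hss => ?_⟩
    have hCle : C ≤ max (max C 0) (4 * Real.log (4 / ε)) :=
      le_trans (le_max_left _ _) (le_max_left _ _)
    have h0le : (0 : ℝ) ≤ max (max C 0) (4 * Real.log (4 / ε)) :=
      le_trans (le_max_right _ _) (le_max_left _ _)
    have h4le : 4 * Real.log (4 / ε) ≤ max (max C 0) (4 * Real.log (4 / ε)) := le_max_right _ _
    by_cases h4 : 4 ≤ ((W.conductorNorm ℤ).primeFactors.filter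
        (fun p => p ≠ 2 ∧ ¬ p ^ 2 ∣ W.conductorNorm ℤ)).card
    · exact (hC W hss h4).trans (by linarith)
    · -- at most three odd multiplicative primes: the census counts at most four primes
      push Not at h4
      have hcnt : ((((W.conductorNorm ℤ).primeFactors.filter
          (fun p => ¬ p ^ 2 ∣ W.conductorNorm ℤ)).filter
          (fun p => ε * Real.log (Real.log (W.conductorNorm ℤ)) <
            Real.log ((W.minimalDiscriminantNorm ℤ).factorization p))).card : ℝ) ≤ 4 := by
        have h1 := Finset.card_filter_le
          ((W.conductorNorm ℤ).primeFactors.filter (fun p => ¬ p ^ 2 ∣ W.conductorNorm ℤ))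
          (fun p => ε * Real.log (Real.log (W.conductorNorm ℤ)) <
            Real.log ((W.minimalDiscriminantNorm ℤ).factorization p))
        have h2 := card_filter_not_sq_dvd_le (W.conductorNorm ℤ)
        have h3 : (((W.conductorNorm ℤ).primeFactors.filter
          (fun p => ¬ p ^ 2 ∣ W.conductorNorm ℤ)).filter
          (fun p => ε * Real.log (Real.log (W.conductorNorm ℤ)) <
            Real.log ((W.minimalDiscriminantNorm ℤ).factorization p))).card ≤ 4 := by omega
        exact_mod_cast h3
      have hcnt0 : (0 : ℝ) ≤ ((((W.conductorNorm ℤ).primeFactors.filter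
          (fun p => ¬ p ^ 2 ∣ W.conductorNorm ℤ)).filter
          (fun p => ε * Real.log (Real.log (W.conductorNorm ℤ)) <
            Real.log ((W.minimalDiscriminantNorm ℤ).factorization p))).card : ℝ) := Nat.cast_nonneg _
      have hL0 : 0 ≤ Real.log (W.conductorNorm ℤ : ℝ) := Real.log_natCast_nonneg _
      have hεL : 0 ≤ ε * Real.log (W.conductorNorm ℤ : ℝ) := mul_nonneg hε.le hL0
      by_cases hLL : Real.log (Real.log (W.conductorNorm ℤ : ℝ)) ≤ 0
      · have hneg := mul_nonpos_of_nonneg_of_nonpos hcnt0 hLL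
        linarith
      · push Not at hLL
        have hLpos : 0 < Real.log (W.conductorNorm ℤ : ℝ) := by
          rcases hL0.lt_or_eq with hlt | heq
          · exact hlt
          · exfalso
            rw [← heq, Real.log_zero] at hLL
            exact lt_irrefl _ hLL
        have key := four_mul_log_le hε hLpos
        have h3 := mul_le_mul_of_nonneg_right hcnt hLL.le
        linarith
  · intro h ε hε
    obtain ⟨C, hC⟩ := h ε hε
    exact ⟨C, fun W _ hss _ => hC W hss⟩

end Summit.ABC.ABC.Theorems.ManyPrimeValuationProduct.Negative
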